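import Mathlib.Analysis.InnerProductSpace.PiL2
import Mathlib.Analysis.InnerProductSpace.GramMatrix

/-!
# Two prescribed inner products leave at most two unit vectors in `ℝ³`

Framing: lottery ticket; floor = certified bounds/negative ranges. Venture `PackingBounds` (cell
`pub-packcert`, seat `pub-packcert-energy`) — a geometric lemma for the uniqueness of the icosahedron.

`reflect_or_eq`: in `ℝ³`, given unit vectors `x, e` with `⟪x,e⟫ = a`, `a² ≠ 1`, two unit vectors `y, ỹ` with the
same inner products `p` against `x` and `q` against `e` are either equal or mirror images in the plane `span{x, e}`:
`ỹ = 2(αx + βe) - y` with `α = (p - aq)/(1 - a²)`, `β = (q - ap)/(1 - a²)` (the components `y - αx - βe` and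
`ỹ - αx - βe` lie on the normal line of the plane and have equal length). Proof by linear dependence of four vectors
in `ℝ³` (`finrank = 3`).
-/

noncomputable section

namespace Summit.Ventures.PackingBounds.Config

open Module

set_option maxHeartbeats 800000 in
/-- **Mirror-or-equal lemma in `ℝ³`.** [folklore] -/
theorem reflect_or_eq {x e y z : EuclideanSpace ℝ (Fin 3)} {a p q : ℝ}
    (hx : ‖x‖ = 1) (he : ‖e‖ = 1) (hy : ‖y‖ = 1) (hz : ‖z‖ = 1) (ha : inner ℝ x e = a) (ha1 : a ^ 2 ≠ 1)
    (hyx : inner ℝ x y = p) (hzx : inner ℝ x z = p) (hye : inner ℝ e y = q) (hze : inner ℝ e z = q) :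
    z = y ∨ z = (2 : ℝ) • (((p - a * q) / (1 - a ^ 2)) • x + ((q - a * p) / (1 - a ^ 2)) • e) - y := by
  set α : ℝ := (p - a * q) / (1 - a ^ 2) with hαdef
  set β : ℝ := (q - a * p) / (1 - a ^ 2) with hβdef
  have h1a : (1 : ℝ) - a ^ 2 ≠ 0 := sub_ne_zero.mpr (Ne.symm ha1)
  have hxx : inner ℝ x x = 1 := by rw [real_inner_self_eq_norm_sq, hx]; norm_num
  have hee : inner ℝ e e = 1 := by rw [real_inner_self_eq_norm_sq, he]; norm_num
  have hyy : inner ℝ y y = 1 := by rw [real_inner_self_eq_norm_sq, hy]; norm_num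
  have hzz : inner ℝ z z = 1 := by rw [real_inner_self_eq_norm_sq, hz]; norm_num
  have hex : inner ℝ e x = a := by rw [real_inner_comm]; exact ha
  -- the key scalar identities for `α, β`
  have hαβ1 : α + β * a = p := by rw [hαdef, hβdef]; field_simp; ring
  have hαβ2 : α * a + β = q := by rw [hαdef, hβdef]; field_simp; ring
  set m : EuclideanSpace ℝ (Fin 3) := α • x + β • e with hmdef
  set v : EuclideanSpace ℝ (Fin 3) := y - m with hvdef
  set w : EuclideanSpace ℝ (Fin 3) := z - m with hwdef
  have hvx : inner ℝ x v = 0 := by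
    rw [hvdef, hmdef, inner_sub_right, inner_add_right, real_inner_smul_right, real_inner_smul_right,
      hyx, hxx, ha]; linarith
  have hwx : inner ℝ x w = 0 := by
    rw [hwdef, hmdef, inner_sub_right, inner_add_right, real_inner_smul_right, real_inner_smul_right,
      hzx, hxx, ha]; linarith
  have hve : inner ℝ e v = 0 := by
    rw [hvdef, hmdef, inner_sub_right, inner_add_right, real_inner_smul_right, real_inner_smul_right,
      hye, hex, hee]; linarith
  have hwe : inner ℝ e w = 0 := by
    rw [hwdef, hmdef, inner_sub_right, inner_add_right, real_inner_smul_right, real_inner_smul_right,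
      hze, hex, hee]; linarith
  -- `‖v‖² = ‖w‖²`
  have hmm : inner ℝ m m = α * α + 2 * α * β * a + β * β := by
    rw [hmdef, inner_add_left, inner_add_right, inner_add_right, real_inner_smul_left, real_inner_smul_left,
      real_inner_smul_right, real_inner_smul_right, real_inner_smul_left, real_inner_smul_right,
      real_inner_smul_left, real_inner_smul_right, hxx, hee, ha, hex]; ring
  have hym : inner ℝ y m = α * p + β * q := by
    rw [hmdef, inner_add_right, real_inner_smul_right, real_inner_smul_right, real_inner_comm x y, hyx,
      real_inner_comm e y, hye]
  have hzm : inner ℝ z m = α * p + β * q := by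
    rw [hmdef, inner_add_right, real_inner_smul_right, real_inner_smul_right, real_inner_comm x z, hzx,
      real_inner_comm e z, hze]
  have hvv : inner ℝ v v = 1 - 2 * (α * p + β * q) + (α * α + 2 * α * β * a + β * β) := by
    rw [hvdef, inner_sub_left, inner_sub_right, inner_sub_right, hyy, hym, real_inner_comm y m, hym, hmm]; ring
  have hww : inner ℝ w w = 1 - 2 * (α * p + β * q) + (α * α + 2 * α * β * a + β * β) := by
    rw [hwdef, inner_sub_left, inner_sub_right, inner_sub_right, hzz, hzm, real_inner_comm z m, hzm, hmm]; ring
  -- four vectors in `ℝ³` are dependent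
  have hdep : ¬ LinearIndependent ℝ ![x, e, v, w] := by
    intro hli
    have h := hli.fintype_card_le_finrank
    rw [finrank_euclideanSpace_fin, Fintype.card_fin] at h
    omega
  rw [Fintype.not_linearIndependent_iff] at hdep
  obtain ⟨g, hg, i, hi⟩ := hdep
  simp only [Fin.sum_univ_four, Matrix.cons_val_zero, Matrix.cons_val_one, Matrix.cons_val] at hg
  -- pair the relation with `x` and `e`: the first two coefficients vanish
  have hgx := congrArg (fun u => inner ℝ x u) hg
  have hge := congrArg (fun u => inner ℝ e u) hg
  simp only [inner_add_right, real_inner_smul_right, inner_zero_right, hxx, ha, hvx, hwx, hex, hee, hve, hwe,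
    mul_zero, add_zero, mul_one] at hgx hge
  have hg0 : g 0 = 0 := by
    have : (1 - a ^ 2) * g 0 = 0 := by linear_combination hgx - a * hge
    rcases mul_eq_zero.mp this with h | h
    · exact absurd h h1a
    · exact h
  have hg1 : g 1 = 0 := by rw [hg0, zero_mul, zero_add] at hge; exact hge
  rw [hg0, hg1, zero_smul, zero_smul, zero_add, zero_add] at hg
  -- so `g 2 • v + g 3 • w = 0` with `(g 2, g 3) ≠ 0`
  have h23 : g 2 ≠ 0 ∨ g 3 ≠ 0 := by
    fin_cases i
    · exact absurd hg0 hi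
    · exact absurd hg1 hi
    · exact Or.inl hi
    · exact Or.inr hi
  -- pair with `v` and `w`
  have hgv := congrArg (fun u => inner ℝ v u) hg
  have hgw := congrArg (fun u => inner ℝ w u) hg
  simp only [inner_add_right, real_inner_smul_right, inner_zero_right] at hgv hgw
  rw [real_inner_comm v w] at hgw
  set ρ := inner ℝ v v with hρ
  set τ := inner ℝ v w with hτ
  have hww' : inner ℝ w w = ρ := by rw [hww, hvv]
  rw [hww'] at hgw
  -- conclude `τ = ±ρ`
  have key : (g 2 ^ 2 + g 3 ^ 2) * (ρ ^ 2 - τ ^ 2) = 0 := by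
    linear_combination (g 2 * ρ - g 3 * τ) * hgv - (g 2 * τ - g 3 * ρ) * hgw
  have hpos : 0 < g 2 ^ 2 + g 3 ^ 2 := by
    rcases h23 with h | h
    · have h2 := sq_pos_iff.mpr h
      linarith [sq_nonneg (g 3)]
    · have h3 := sq_pos_iff.mpr h
      linarith [sq_nonneg (g 2)]
  have hτρ : τ ^ 2 = ρ ^ 2 := by
    rcases mul_eq_zero.mp key with h | h
    · exact absurd h (ne_of_gt hpos)
    · linarith
  rcases sq_eq_sq_iff_eq_or_eq_neg.mp hτρ with h | h
  · -- τ = ρ : then v = w, i.e. z = y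
    left
    have h0 : inner ℝ (v - w) (v - w) = 0 := by
      rw [real_inner_sub_sub_self, hww', ← hτ, ← hρ, h]
      ring
    have hvw : v - w = 0 := inner_self_eq_zero.mp h0
    rw [hvdef, hwdef] at hvw
    have : y - z = 0 := by rw [← hvw]; abel
    exact (sub_eq_zero.mp this).symm
  · -- τ = -ρ : then v + w = 0, i.e. z = 2m - y
    right
    have h0 : inner ℝ (v + w) (v + w) = 0 := by
      rw [real_inner_add_add_self, hww', ← hτ, ← hρ, h]
      ring
    have hvw : v + w = 0 := inner_self_eq_zero.mp h0
    rw [hvdef, hwdef] at hvw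
    have hz' : z = m + m - y := by
      have h' : y - m + (z - m) + (m + m - y) = m + m - y := by rw [hvw, zero_add]
      have h'' : y - m + (z - m) + (m + m - y) = z := by abel
      rw [h''] at h'; exact h'
    rw [hz', hmdef, two_smul]

end Summit.Ventures.PackingBounds.Config

end
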